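import Mathlib
import HarnessLib
import Summits.HubbardSuperconductivity.HubbardSuperconductivity.Theorems.KLProgrammeKLRegimeEngineV8TwoLegMomentsExportGrid

/-!
# Route `KLProgramme` — ENGINE child gen 8 (stmt-HubbardSuperconductivity-20437 `KLRegimeEngineV17F2`), v2 token #23 → **#27**: the class-#7 grid atom with
# PARAMETRISED MIXED SPACE-ROW CURRENCY — plan g20 ruling **(R60) (T′-B)** for located risk #9 «(b)-GRID-FRAME-M1»
# (cell gate-hubbard-kl, seat hubbard-kl-r2d-p1 g9 = class-#7 text owner; evidence `RISK9-CONSUMER-e-r2dp1-g9.md` on 20437)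

WHY.  At the flow frame `K_n ≠ 0` the SPACE row of the grid atom `TwoLegGridMomentsAt` (p557865; first space moment of the plain-leg two-leg kernel of
`W_n[K_n] − 𝒩_{K_n}`) reads the position spread `M₁(K_n)` of the counterterm vertex, certifiable from the registered jets only as a U-FREE floor
`ĉ·m_R`, `ĉ := c/ln 4 + U²` (k3c2-p1 GRID-FRAME-M1 and GRID-FRAME-M1-B).  By Leibniz the first moment is LINEAR in `M₁(K_n)` times an `ℓ¹` norm of another factor
(`ℓ¹(K_n) = O(|U|)`, or a `U`-vertex), so the producible space row is the MIXED currency «`(Zs₁·ĉ·|U| + Zs₂·U²)·β/(2N)`», which the (e) consumer closes with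
ONE c-row `Zs₁·ĉ ≤ 0.05·cz` ((R60): (T) pure-ĉ and (C2) struck; (T′-B) ≻ (c)+(W)).  This file is the SUCCESSOR ATOM with the currency pair `(Zs₁, Zs₂)` as
explicit parameters (arity (B)); the time row is unchanged (`Zt·U²`):

* `TwoLegGridMomentsAtC L M Zt Zs₁ Zs₂ c β U μ K n` / `TwoLegGridFlowMomentsAtC L M Zt Zs₁ Zs₂ c β U μ n` (at `K := K_n`);
* bookkeeping: `.mono`, **`TwoLegGridMomentsAt.toC`** (old atom ⇒ new at `(Zs₁, Zs₂) = (0, Zs)`, any `c` — so every landed producer of the old text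
  feeds the new one; (W) at T+ is a PROOF ROUTE to `Zs₁ = 0`), **`TwoLegGridMomentsAtC.toMomentsAt`** (new ⇒ old with `Zs := Zs₁·ĉ/|U| + Zs₂`, `U ≠ 0` — so every
  landed CONSUMER of the old text reads the new one verbatim; only the final fits move), the slope sizes `twoLeg_slopeSizes_of_twoLegGridMomentsAtC`
  (B1′ `≤ Zt·U²`, B2′ `≤ Zs₁·ĉ·|U| + Zs₂·U²`), and the `n = 0` base `twoLegGridFlowMomentsAtC_zero_klE3A1` at `(Zs₁, Zs₂) = (0, 2¹¹e¹⁸κ₀⁴·klE3A1 R)`.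

Definitions with bodies + proofs; nothing about the model is asserted beyond the `n = 0` base already in the tree; nothing asserts any stub of 20437, K3 or
superconductivity.  References: BGM 2006 §2.1 (2.4)–(2.5), §2.4 (2.36) [cite: BenfattoGiulianiMastropietro2006].
-/

noncomputable section

namespace Summit.HubbardSuperconductivity.HubbardSuperconductivity.Theorems.KLRegimeSplit

set_option linter.dupNamespace false -- summit = problem name (single-conjunct summit), D-0017

open Finset Complex
open Literature.MathematicalPhysics.QuantumLattice Literature.Probability.LatticeModels GrassmannAlgebra
open Summit.HubbardSuperconductivity.HubbardSuperconductivity.Theorems.KLProgrammeLegKernels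

/-! ## §1 The successor atom (token #27): time row `Zt·U²`, space row `(Zs₁·ĉ·|U| + Zs₂·U²)`, `ĉ = c/ln 4 + U²` -/

section Model

variable (L M : ℕ) [NeZero L]

/-- **`TwoLegGridMomentsAtC L M Zt Zs₁ Zs₂ c β U μ K n`** — the grid two-leg moments atom with PARAMETRISED MIXED space-row currency ((R60) (T′-B)): the object and
the TIME row are `TwoLegGridMomentsAt`'s verbatim (`≤ Zt·U²·β/(2N)`); the SPACE row is `≤ (Zs₁·(c/ln 4 + U²)·|U| + Zs₂·U²)·β/(2N)` — `Zs₁` multiplies the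
U-free frame-spread floor `ĉ = c/ln 4 + U²` (times the `|U|` of the other factor), `Zs₂` the genuine second-order part. -/
def TwoLegGridMomentsAtC (Zt Zs₁ Zs₂ : ℝ) (c β U μ : ℝ) (K : TrigPolyC4v) (n : ℕ) : Prop :=
  (∀ (σ : Fin 2) (p₀ : GridPoint L (2 * (2 * M))), ∑ p₁ : GridPoint L (2 * (2 * M)),
      β / ((2 * (2 * M) : ℕ) : ℝ) * (circDist (2 * (2 * M)) p₀.1.val p₁.1.val : ℝ) *
        ‖kernel ℂ
          (effAction ℂ ((hubbardGridSub L M β (2 * (2 * M))).transpose *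
              hubbardCovAboveCT L M β μ 0 K (klScale klE0 n) * hubbardGridSub L M β (2 * (2 * M)))
            (hubbardGridInteraction L (2 * (2 * M)) β U + hubbardGridCounterQuadratic L (2 * (2 * M)) β K) -
            hubbardGridCounterQuadratic L (2 * (2 * M)) β K) 2
          (fun i => ((![p₀, p₁] i, σ), i))‖ ≤ Zt * U ^ 2 * (β / (2 * ((2 * (2 * M) : ℕ) : ℝ)))) ∧
  (∀ (σ : Fin 2) (p₀ : GridPoint L (2 * (2 * M))), ∑ p₁ : GridPoint L (2 * (2 * M)),
      (if p₁.2 - p₀.2 = 0 then (0 : ℝ) else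
        (1 + (((p₁.2 - p₀.2) 0).valMinAbs.natAbs : ℝ) + (((p₁.2 - p₀.2) 1).valMinAbs.natAbs : ℝ)) ^ 1) *
        ‖kernel ℂ
          (effAction ℂ ((hubbardGridSub L M β (2 * (2 * M))).transpose *
              hubbardCovAboveCT L M β μ 0 K (klScale klE0 n) * hubbardGridSub L M β (2 * (2 * M)))
            (hubbardGridInteraction L (2 * (2 * M)) β U + hubbardGridCounterQuadratic L (2 * (2 * M)) β K) -
            hubbardGridCounterQuadratic L (2 * (2 * M)) β K) 2
          (fun i => ((![p₀, p₁] i, σ), i))‖ ≤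
        (Zs₁ * (c / Real.log 4 + U ^ 2) * |U| + Zs₂ * U ^ 2) * (β / (2 * ((2 * (2 * M) : ℕ) : ℝ))))

variable {L M}

/-- **Old atom ⇒ new atom at `(Zs₁, Zs₂) = (0, Zs)`** (any `c`): every landed producer of `TwoLegGridMomentsAt` feeds the C-atom; (W) at T+ is a proof route to
`Zs₁ = 0`. -/
theorem TwoLegGridMomentsAt.toC {Zt Zs β U μ : ℝ} {K : TrigPolyC4v} {n : ℕ} (h : TwoLegGridMomentsAt L M Zt Zs β U μ K n) (c : ℝ) :
    TwoLegGridMomentsAtC L M Zt 0 Zs c β U μ K n :=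
  ⟨h.1, fun σ p₀ => (h.2 σ p₀).trans (le_of_eq (by ring))⟩

/-- **New atom ⇒ old atom with `Zs := Zs₁·ĉ/|U| + Zs₂`** (`U ≠ 0`): every landed CONSUMER of `TwoLegGridMomentsAt` (slope sizes, rows C1/C2 projections) reads the
C-atom verbatim; only the final fits see the currency. -/
theorem TwoLegGridMomentsAtC.toMomentsAt {Zt Zs₁ Zs₂ c β U μ : ℝ} {K : TrigPolyC4v} {n : ℕ} (h : TwoLegGridMomentsAtC L M Zt Zs₁ Zs₂ c β U μ K n)
    (hU : U ≠ 0) : TwoLegGridMomentsAt L M Zt (Zs₁ * (c / Real.log 4 + U ^ 2) / |U| + Zs₂) β U μ K n := by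
  refine ⟨h.1, fun σ p₀ => (h.2 σ p₀).trans (le_of_eq ?_)⟩
  have hU' : |U| ≠ 0 := abs_ne_zero.2 hU
  have hsq : U ^ 2 = |U| * |U| := by rw [← sq_abs, pow_two]
  rw [hsq]
  field_simp

/-- The mixed space budget in the old currency: `(Zs₁·ĉ/|U| + Zs₂)·U² = Zs₁·ĉ·|U| + Zs₂·U²` (`U ≠ 0`). -/
theorem mixedSpaceBudget_mul_sq {Zs₁ Zs₂ c U : ℝ} (hU : U ≠ 0) :
    (Zs₁ * (c / Real.log 4 + U ^ 2) / |U| + Zs₂) * U ^ 2 = Zs₁ * (c / Real.log 4 + U ^ 2) * |U| + Zs₂ * U ^ 2 := by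
  have hU' : |U| ≠ 0 := abs_ne_zero.2 hU
  have hsq : U ^ 2 = |U| * |U| := by rw [← sq_abs, pow_two]
  rw [hsq]
  field_simp

/-- `0 ≤ ĉ = c/ln 4 + U²` for `0 ≤ c`. -/
theorem cHat_nonneg {c : ℝ} (hc : 0 ≤ c) (U : ℝ) : 0 ≤ c / Real.log 4 + U ^ 2 := by
  have hlog : 0 < Real.log 4 := Real.log_pos (by norm_num)
  positivity

/-- Budget monotonicity of the C-atom (`0 ≤ β`, `0 ≤ c`). -/
theorem TwoLegGridMomentsAtC.mono {Zt Zs₁ Zs₂ Zt' Zs₁' Zs₂' c β U μ : ℝ} {K : TrigPolyC4v} {n : ℕ}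
    (h : TwoLegGridMomentsAtC L M Zt Zs₁ Zs₂ c β U μ K n) (hβ : 0 ≤ β) (hc : 0 ≤ c) (ht : Zt ≤ Zt') (hs₁ : Zs₁ ≤ Zs₁') (hs₂ : Zs₂ ≤ Zs₂') :
    TwoLegGridMomentsAtC L M Zt' Zs₁' Zs₂' c β U μ K n := by
  have hw : 0 ≤ β / (2 * ((2 * (2 * M) : ℕ) : ℝ)) := by positivity
  have hĉ := cHat_nonneg hc U
  refine ⟨fun σ p₀ => (h.1 σ p₀).trans (mul_le_mul_of_nonneg_right (mul_le_mul_of_nonneg_right ht (sq_nonneg U)) hw),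
    fun σ p₀ => (h.2 σ p₀).trans (mul_le_mul_of_nonneg_right ?_ hw)⟩
  have h1 : Zs₁ * (c / Real.log 4 + U ^ 2) * |U| ≤ Zs₁' * (c / Real.log 4 + U ^ 2) * |U| :=
    mul_le_mul_of_nonneg_right (mul_le_mul_of_nonneg_right hs₁ hĉ) (abs_nonneg U)
  have h2 : Zs₂ * U ^ 2 ≤ Zs₂' * U ^ 2 := mul_le_mul_of_nonneg_right hs₂ (sq_nonneg U)
  linarith

variable (L M) [NeZero M]

/-- **`TwoLegGridFlowMomentsAtC L M Zt Zs₁ Zs₂ c β U μ n`** — the class-#7 export in the mixed currency: the C-atom at the flow frame `K_n`. -/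
def TwoLegGridFlowMomentsAtC (Zt Zs₁ Zs₂ : ℝ) (c β U μ : ℝ) (n : ℕ) : Prop :=
  TwoLegGridMomentsAtC L M Zt Zs₁ Zs₂ c β U μ (klFlowFrameU L M β U μ n) n

variable {L M}

/-- The export IS the C-atom at the flow frame. -/
theorem twoLegGridFlowMomentsAtC_iff (Zt Zs₁ Zs₂ c β U μ : ℝ) (n : ℕ) :
    TwoLegGridFlowMomentsAtC L M Zt Zs₁ Zs₂ c β U μ n ↔ TwoLegGridMomentsAtC L M Zt Zs₁ Zs₂ c β U μ (klFlowFrameU L M β U μ n) n := Iff.rfl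

/-- Old export ⇒ new export at `(0, Zs)`. -/
theorem TwoLegGridFlowMomentsAt.toC {Zt Zs β U μ : ℝ} {n : ℕ} (h : TwoLegGridFlowMomentsAt L M Zt Zs β U μ n) (c : ℝ) :
    TwoLegGridFlowMomentsAtC L M Zt 0 Zs c β U μ n :=
  TwoLegGridMomentsAt.toC h c

/-- New export ⇒ old export with `Zs := Zs₁·ĉ/|U| + Zs₂` (`U ≠ 0`). -/
theorem TwoLegGridFlowMomentsAtC.toFlowMomentsAt {Zt Zs₁ Zs₂ c β U μ : ℝ} {n : ℕ} (h : TwoLegGridFlowMomentsAtC L M Zt Zs₁ Zs₂ c β U μ n)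
    (hU : U ≠ 0) : TwoLegGridFlowMomentsAt L M Zt (Zs₁ * (c / Real.log 4 + U ^ 2) / |U| + Zs₂) β U μ n :=
  TwoLegGridMomentsAtC.toMomentsAt h hU

/-- Budget monotonicity of the C-export (`0 ≤ β`, `0 ≤ c`). -/
theorem TwoLegGridFlowMomentsAtC.mono {Zt Zs₁ Zs₂ Zt' Zs₁' Zs₂' c β U μ : ℝ} {n : ℕ} (h : TwoLegGridFlowMomentsAtC L M Zt Zs₁ Zs₂ c β U μ n)
    (hβ : 0 ≤ β) (hc : 0 ≤ c) (ht : Zt ≤ Zt') (hs₁ : Zs₁ ≤ Zs₁') (hs₂ : Zs₂ ≤ Zs₂') : TwoLegGridFlowMomentsAtC L M Zt' Zs₁' Zs₂' c β U μ n :=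
  TwoLegGridMomentsAtC.mono h hβ hc ht hs₁ hs₂

end Model

end Summit.HubbardSuperconductivity.HubbardSuperconductivity.Theorems.KLRegimeSplit

/-! ## §2 Consumers' doors and the `n = 0` base in the mixed currency -/

namespace Summit.HubbardSuperconductivity.HubbardSuperconductivity.Theorems.EngineV8

set_option linter.dupNamespace false -- summit = problem name (single-conjunct summit), D-0017

open Finset Complex
open Literature.MathematicalPhysics.QuantumLattice Literature.Probability.LatticeModels GrassmannAlgebra
open Summit.HubbardSuperconductivity.HubbardSuperconductivity.Theorems.KLRegimeSplit
open Summit.HubbardSuperconductivity.HubbardSuperconductivity.Theorems.KLProgrammeLegKernels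
open Summit.HubbardSuperconductivity.HubbardSuperconductivity.Theorems.TwoLegFourier

/-- **THE TWO SLOPE SIZES FROM THE C-ATOM** (`0 < β`, `U ≠ 0`): `|klFieldStrength … K n k − 1| ≤ Zt·U²` at every torus momentum (B1′) and
`‖fderiv (evalM (symInterp L (σ_n − K∘p))) q‖ ≤ Zs₁·(c/ln 4 + U²)·|U| + Zs₂·U²` at every `q` (B2′, mixed currency). -/
theorem twoLeg_slopeSizes_of_twoLegGridMomentsAtC {L M : ℕ} [NeZero L] [NeZero M] {β : ℝ} (hβ : 0 < β) {U : ℝ} (hU : U ≠ 0) {μ c : ℝ}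
    {K : TrigPolyC4v} {n : ℕ} {Zt Zs₁ Zs₂ : ℝ} (h : TwoLegGridMomentsAtC L M Zt Zs₁ Zs₂ c β U μ K n) :
    (∀ k : TorusSite 2 L, |klFieldStrength L M β U μ K n k - 1| ≤ Zt * U ^ 2) ∧
    ∀ q : Momentum, ‖fderiv ℝ
      (evalM (symInterp L (fun p => klLocSelfEnergyRe L M β U μ K n p - K.eval (latticeMomentum L p)))) q‖ ≤
        Zs₁ * (c / Real.log 4 + U ^ 2) * |U| + Zs₂ * U ^ 2 := by
  obtain ⟨hz, hs⟩ := twoLeg_slopeSizes_of_twoLegGridMomentsAt hβ (h.toMomentsAt hU)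
  exact ⟨hz, fun q => (hs q).trans (le_of_eq (mixedSpaceBudget_mul_sq hU))⟩

section Base

variable {L M : ℕ} [NeZero L] [NeZero M] {R : RenConsts} {β U μ : ℝ}

/-- **THE n = 0 BASE OF THE C-EXPORT UNDER THE REGISTERED DOOR** at `(Zs₁, Zs₂) = (0, 2¹¹e¹⁸κ₀⁴·klE3A1 R)` (the old base `twoLegGridFlowMomentsAt_zero_klE3A1`, any
`c`): `K₀ = 0` has no counterterm, so the space row is pure `U²`. -/
theorem twoLegGridFlowMomentsAtC_zero_klE3A1 (P : SplitConsts) (hR : R.WF2) {c c' : ℝ} (hμ : μ ∈ klWindowC) (hU : 0 < U)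
    (hUle : U ≤ klEngU₀9 P R c) (hβ : klBetaMin ≤ β) (hL : klEngL₃ β U ≤ L) (hM : klEngM₃ β U L ≤ M) :
    TwoLegGridFlowMomentsAtC L M ((2 : ℝ) ^ 10 * Real.exp 1 ^ 18 * Real.sqrt (2 * (7 + 1606732)) ^ 4 * klE3A1 R) 0
      ((2 : ℝ) ^ 11 * Real.exp 1 ^ 18 * Real.sqrt (2 * (7 + 1606732)) ^ 4 * klE3A1 R) c' β U μ 0 :=
  (twoLegGridFlowMomentsAt_zero_klE3A1 P hR hμ hU hUle hβ hL hM).toC c'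

end Base

end Summit.HubbardSuperconductivity.HubbardSuperconductivity.Theorems.EngineV8

end
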